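import Literature.MathematicalPhysics.QuantumFieldTheory.BalabanSoftAveraging

/-!
# Crux `SusceptibilityToPoincare` (stmt-QuantumFields-9441), line `rg-variance-cascade` — stub `stub_truncFiltration` (A3)

The truncation maps `T j (U, V) = (k ↦ if j ≤ k then V k else 1)` of the multi-resolution space
`GaugeConfig 4 (2S+1) G × Π_{k<n} GaugeConfig 4 (blockSide (2S+1) b^(k+1)) G` generate a comap-filtration
`𝓖_j = comap (T j)` of sub-σ-algebras of the product σ-algebra which is decreasing in `j` and equal to `⊥`
at level `n` (pure measure-theoretic bookkeeping; Mathlib only).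
-/

noncomputable section

open MeasureTheory
open Literature.MathematicalPhysics.QuantumFieldTheory

namespace Summit.QuantumFields.YangMills.Theorems.SusceptibilityToPoincare.RgVarianceCascade

namespace TruncFiltration

/-- The coordinatewise overwrite `c ↦ (i ↦ if p i then c i else d i)` of a product by a fixed default
off a decidable index set is measurable for the product σ-algebras (each component is a coordinate
projection or a constant). [folklore] -/
theorem measurable_overwrite {ι : Type*} {X : ι → Type*} [∀ i, MeasurableSpace (X i)]
    (p : ι → Prop) [DecidablePred p] (d : ∀ i, X i) :
    Measurable (fun (c : ∀ i, X i) (i : ι) => if p i then c i else d i) := by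
  refine measurable_pi_lambda _ fun i => ?_
  by_cases h : p i
  · simp only [if_pos h]
    exact measurable_pi_apply i
  · simp only [if_neg h]
    exact measurable_const

end TruncFiltration

open TruncFiltration in
/-- `stub_truncFiltration` — **A3, the truncation maps generate a decreasing filtration ending at `⊥`.**
For the truncation `T j ω = (k ↦ if j ≤ k then ω.2 k else 1)` keeping the coarse levels `≥ j` of
`ω = (U, V) ∈ GaugeConfig × Π_k Coarse_k`: every `T j` is measurable (each component is a coordinate
projection of `ω.2` or a constant), so `comap (T j) ≤` the product σ-algebra (`Measurable.comap_le`);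
`T (j+1) = g_j ∘ T j` with the measurable overwrite `g_j c = (k ↦ if j+1 ≤ k then c k else 1)`, so
`comap (T (j+1)) ≤ comap (T j)` (`MeasurableSpace.comap_le_comap_of_eq_comp`); and `T n` is the constant
map (`k < n` for `k : Fin n`), so `comap (T n) = ⊥` (`MeasurableSpace.comap_const`). [folklore] -/
theorem stub_truncFiltration :
    ∀ (G : Type) [Group G] [MeasurableSpace G] (S b n : ℕ)
      (T : ℕ → GaugeConfig 4 (2 * S + 1) G ×
          ((k : Fin n) → GaugeConfig 4 (BalabanAveraging.blockSide (2 * S + 1) (b ^ ((k : ℕ) + 1))) G) →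
          ((k : Fin n) → GaugeConfig 4 (BalabanAveraging.blockSide (2 * S + 1) (b ^ ((k : ℕ) + 1))) G)),
      (∀ j ω k, T j ω k = if j ≤ (k : ℕ) then ω.2 k else fun _ => 1) →
      (∀ j : ℕ, MeasurableSpace.comap (T j) inferInstance ≤
        (inferInstance : MeasurableSpace (GaugeConfig 4 (2 * S + 1) G ×
          ((k : Fin n) → GaugeConfig 4 (BalabanAveraging.blockSide (2 * S + 1) (b ^ ((k : ℕ) + 1))) G)))) ∧
      (∀ j : ℕ, MeasurableSpace.comap (T (j + 1)) inferInstance ≤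
        (MeasurableSpace.comap (T j) inferInstance : MeasurableSpace (GaugeConfig 4 (2 * S + 1) G ×
          ((k : Fin n) → GaugeConfig 4 (BalabanAveraging.blockSide (2 * S + 1) (b ^ ((k : ℕ) + 1))) G)))) ∧
      MeasurableSpace.comap (T n) inferInstance =
        (⊥ : MeasurableSpace (GaugeConfig 4 (2 * S + 1) G ×
          ((k : Fin n) → GaugeConfig 4 (BalabanAveraging.blockSide (2 * S + 1) (b ^ ((k : ℕ) + 1))) G))) := by
  intro G _ _ S b n T hT
  -- `T j` is the overwrite of the coarse component `ω.2` below level `j` by the constant field `1`.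
  have hTeq : ∀ j : ℕ, T j =
      (fun (c : (k : Fin n) →
          GaugeConfig 4 (BalabanAveraging.blockSide (2 * S + 1) (b ^ ((k : ℕ) + 1))) G) (k : Fin n) =>
        if j ≤ (k : ℕ) then c k else fun _ => 1) ∘ Prod.snd := by
    intro j
    funext ω k
    exact hT j ω k
  have hmeas : ∀ j : ℕ, Measurable (T j) := by
    intro j
    rw [hTeq j]
    exact (measurable_overwrite (fun k : Fin n => j ≤ (k : ℕ)) _).comp measurable_snd
  refine ⟨fun j => (hmeas j).comap_le, fun j => ?_, ?_⟩
  · -- `T (j+1) = g_j ∘ T j` with the measurable overwrite `g_j` at level `j + 1`.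
    refine MeasurableSpace.comap_le_comap_of_eq_comp
      (fun (c : (k : Fin n) →
          GaugeConfig 4 (BalabanAveraging.blockSide (2 * S + 1) (b ^ ((k : ℕ) + 1))) G) (k : Fin n) =>
        if j + 1 ≤ (k : ℕ) then c k else fun _ => 1)
      (measurable_overwrite (fun k : Fin n => j + 1 ≤ (k : ℕ)) _) ?_
    funext ω k
    simp only [Function.comp_apply]
    rw [hT, hT]
    by_cases h : j + 1 ≤ (k : ℕ)
    · have h' : j ≤ (k : ℕ) := Nat.le_of_succ_le h
      rw [if_pos h, if_pos h, if_pos h']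
    · rw [if_neg h, if_neg h]
  · -- `T n` is constant: no `k : Fin n` has `n ≤ k`.
    have hconst : T n = fun _ => fun _ _ => 1 := by
      funext ω k
      rw [hT, if_neg (Nat.not_le.mpr k.isLt)]
    rw [hconst]
    exact MeasurableSpace.comap_const _

end Summit.QuantumFields.YangMills.Theorems.SusceptibilityToPoincare.RgVarianceCascade

end
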